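import Summits.Ventures.PercRepro.MSTightMergeData
import Summits.Ventures.PercRepro.MSTightAnatomyGround

/-!
# The merge: a residue instance with an outside member yields an instance on `u ∪ {m}` whose
# outside members all pass through `m`, and its witness lifts (Addendum 39, Steps 2–3)

Dossier proofs/MINE1-theoremS.md, Addendum 39 (Steps 2, 3), and proofs/MINE1-RSTARM-PROOF.md §5
(the merge), §6. Let `RInst S L' T u` be a residue instance (`T` not tight) with no singleton of
`ū` in `U` and some member outside `u`, and let `m ∉ u` be a vertex; `mergeL`, `mergeT` are the
merged data of MSTightMergeData.lean.
**Theorem `RInst.merge`:** the merged data is an instance on `insert m u` (with the same `u`, the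
same valid sets, (Sig) and (AO) unchanged); the count (Cnt) is
`|faces'''| = |A_u ∩ C_u| + |Λ ∩ 𝒬| = |P| + 1 + |Λ ∩ 𝒬| ≤ |P| + 1 + |K⁺| = |mergeT| + 1`
by the count (R) (MSTightRestriction.lean) and the block lemma (BNT) (MSTightMergeSetup.lean).
**Theorem `RInst.exists_witness_of_merge`:** a witness of the merged instance gives a witness of
`T` — a witness inside `u` is one of `T`; a witness `insert m t` has its trace `t` in `Λ`, i.e.
`u ∖ t ∈ U`, and under (S1) (which holds when `T` has no witness, MSTightAnatomyGround.lean)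
`u ∖ t` is a witness of `T` (the lift).
-/

namespace PercRepro.MSTight

open Finset
open scoped FinsetFamily

variable {α : Type*} [DecidableEq α] [Fintype α]

namespace RInst

variable {S u : Finset α} {L' T : Finset (Finset α)} {m : α}

/-- **(Cnt) for the merged data:** `|faces'''| ≤ |mergeT| + 1`, by the count (R) and (BNT). -/
theorem card_faces_merge_le (h : RInst S L' T u) (hnt : ¬ Tight T)
    (hB : ∀ m ∈ S \ u, S.erase m ∉ L') (hmu : m ∉ u) :
    ((mergeL S u L' m).filter fun w => ∃ y ∈ mergeT T u m, w ⊆ y).card ≤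
      (mergeT T u m).card + 1 := by
  have hsplit := card_filter_add_card_filter_not (fun w => m ∈ w)
    (s := (mergeL S u L' m).filter fun w => ∃ y ∈ mergeT T u m, w ⊆ y)
  rw [faces_merge_filter_mem hmu, faces_merge_filter_notMem hmu, card_image_of_injOn] at hsplit
  · have hR := card_faces_restrict_eq_succ (u := u) h.hdown h.hne h.hTS h.hTU h.hcnt h.huS h.hu
      h.hsig h.hao
    have hBNT := h.card_link_inter_outFaces_le hnt hB
    have hT := card_mergeT (T := T) hmu
    have hPQ := card_inter_outFaces_eq T u
    have hP := card_sdiff_add_card_eq_card (filter_subset_image_inter T u)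
    omega
  · intro x hx x' hx' hxx'
    have hxu : x ⊆ u := (mem_link.1 (mem_inter.1 (mem_coe.1 hx)).1).1
    have hx'u : x' ⊆ u := (mem_link.1 (mem_inter.1 (mem_coe.1 hx')).1).1
    have h1 : m ∉ x := fun h' => hmu (hxu h')
    have h2 : m ∉ x' := fun h' => hmu (hx'u h')
    rw [← erase_insert h1, ← erase_insert h2, hxx']

/-- **The merge (Addendum 39, Step 2).** A residue instance with no singleton of `ū` in `U` and an
outside member gives, for any `m ∉ u`, an instance on the ground set `insert m u`. -/
theorem merge (h : RInst S L' T u) (hnt : ¬ Tight T) (hB : ∀ m ∈ S \ u, S.erase m ∉ L')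
    (hmu : m ∉ u) (hout : ∃ y ∈ T, ¬ y ⊆ u) :
    RInst (insert m u) (mergeL S u L' m) (mergeT T u m) u where
  hdown := by
    intro w hw w' hw'
    rcases mem_mergeL.1 hw with ⟨hwL, hwu⟩ | ⟨x, hx, rfl⟩
    · exact mem_mergeL.2 (Or.inl ⟨h.hdown w hwL w' hw', hw'.trans hwu⟩)
    · have hxu : x ⊆ u := (mem_link.1 hx).1
      by_cases hmw : m ∈ w'
      · refine mem_mergeL.2 (Or.inr ⟨w'.erase m, ?_, insert_erase hmw⟩)
        refine mem_link.2 ⟨?_, ?_⟩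
        · intro a ha
          rw [mem_erase] at ha
          have := hw' ha.2
          rw [mem_insert] at this
          rcases this with rfl | h'
          · exact absurd rfl ha.1
          · exact hxu h'
        · refine h.upSet_up _ (mem_link.1 hx).2 _ ?_
          intro a ha
          rw [mem_sdiff] at ha ⊢
          refine ⟨ha.1, fun h' => ha.2 ?_⟩
          have := hw' (mem_erase.1 h').2
          rw [mem_insert] at this
          rcases this with rfl | h''
          · exact absurd rfl (mem_erase.1 h').1
          · exact h''
      · refine mem_mergeL.2 (Or.inl ⟨h.hdown _ (h.mem_of_mem_link hx) w' ?_, ?_⟩)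
        · intro a ha
          have := hw' ha
          rw [mem_insert] at this
          rcases this with rfl | h'
          · exact absurd ha hmw
          · exact h'
        · intro a ha
          have := hw' ha
          rw [mem_insert] at this
          rcases this with rfl | h'
          · exact absurd ha hmw
          · exact hxu h'
  hLS := by
    intro w hw
    rcases mem_mergeL.1 hw with ⟨-, hwu⟩ | ⟨x, hx, rfl⟩
    · exact hwu.trans (subset_insert m u)
    · exact insert_subset_insert m (mem_link.1 hx).1
  hsing := by
    intro a ha
    rw [mem_insert] at ha
    rcases ha with rfl | ha
    · exact mem_mergeL.2 (Or.inr ⟨∅, h.empty_mem_link, insert_empty⟩)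
    · exact mem_mergeL.2 (Or.inl ⟨h.hsing a (h.huS ha), singleton_subset_iff.2 ha⟩)
  hS := by
    intro hS
    rcases mem_mergeL.1 hS with ⟨-, hwu⟩ | ⟨x, hx, hxeq⟩
    · exact hmu (hwu (mem_insert_self m u))
    · have hxu : x ⊆ u := (mem_link.1 hx).1
      have hmx : m ∉ x := fun h' => hmu (hxu h')
      have : x = u := by
        rw [← erase_insert hmx, hxeq, erase_insert hmu]
      exact h.not_mem_link (this ▸ hx)
  hne := by
    obtain ⟨y, hy, hyu⟩ := hout
    exact ⟨insert m (y ∩ u), mem_mergeT.2 (Or.inr ⟨y ∩ u,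
      ⟨⟨y, hy, rfl⟩, (mem_inter.1 (inter_mem_inter_outFaces hy hyu)).2⟩, rfl⟩)⟩
  hTS := by
    intro y hy
    rcases mem_mergeT.1 hy with ⟨-, hyu⟩ | ⟨t, ⟨⟨y', -, rfl⟩, -⟩, rfl⟩
    · exact hyu.trans (subset_insert m u)
    · exact insert_subset_insert m inter_subset_right
  hTU := by
    intro y hy
    rcases mem_mergeT.1 hy with ⟨hyT, hyu⟩ | ⟨t, ⟨⟨y', hy', rfl⟩, -⟩, rfl⟩
    · have hmy : m ∉ y := fun h' => hmu (hyu h')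
      rw [insert_sdiff_of_notMem _ hmy]
      refine mem_mergeL.2 (Or.inr ⟨u \ y, mem_link.2 ⟨sdiff_subset, ?_⟩, rfl⟩)
      rw [Finset.sdiff_sdiff_eq_self hyu]
      exact h.subset_upSet hyT
    · have : insert m u \ insert m (y' ∩ u) = u \ y' := by
        ext a
        simp only [mem_sdiff, mem_insert, mem_inter, not_or, not_and]
        constructor
        · rintro ⟨ha, hne, hnot⟩
          rcases ha with rfl | hau
          · exact absurd rfl hne
          · exact ⟨hau, fun h' => hnot h' hau⟩
        · rintro ⟨hau, hay⟩
          exact ⟨Or.inr hau, fun h' => hmu (h' ▸ hau), fun h' _ => hay h'⟩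
      rw [this]
      exact mem_mergeL.2 (Or.inl ⟨h.hdown _ (h.hTU y' hy') _
        (sdiff_subset_sdiff h.huS (subset_refl _)), sdiff_subset⟩)
  hcnt := h.card_faces_merge_le hnt hB hmu
  huS := subset_insert m u
  hu := by
    intro hu
    rcases mem_mergeL.1 hu with ⟨huL, -⟩ | ⟨x, -, hxeq⟩
    · exact h.hu huL
    · exact hmu (hxeq ▸ mem_insert_self m x)
  huU := by
    rw [insert_sdiff_of_notMem u hmu, Finset.sdiff_self]
    exact mem_mergeL.2 (Or.inr ⟨∅, h.empty_mem_link, rfl⟩)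
  hsig := by
    intro v hv hvu
    have hvL : v ∈ L' := by
      rcases mem_mergeL.1 hv with ⟨hvL, -⟩ | ⟨x, -, rfl⟩
      · exact hvL
      · exact absurd (hvu (mem_insert_self m x)) hmu
    rcases h.hsig v hvL hvu with h' | ⟨y, hy, hvy⟩
    · exact Or.inl (mem_mergeL.2 (Or.inl ⟨h', sdiff_subset⟩))
    · right
      by_cases hyu : y ⊆ u
      · exact ⟨y, mem_mergeT.2 (Or.inl ⟨hy, hyu⟩), hvy⟩
      · refine ⟨insert m (y ∩ u), mem_mergeT.2 (Or.inr ⟨y ∩ u,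
          ⟨⟨y, hy, rfl⟩, (mem_inter.1 (inter_mem_inter_outFaces hy hyu)).2⟩, rfl⟩), ?_⟩
        exact (subset_inter hvy hvu).trans (subset_insert _ _)
  hao := by
    obtain ⟨v₀, hv₀, hv₀u, hv₀c, hv₀T⟩ := h.hao
    refine ⟨v₀, mem_mergeL.2 (Or.inl ⟨hv₀, hv₀u⟩), hv₀u,
      mem_mergeL.2 (Or.inl ⟨hv₀c, sdiff_subset⟩), ?_⟩
    intro y hy hsub
    rcases mem_mergeT.1 hy with ⟨hyT, -⟩ | ⟨t, ⟨⟨y', hy', rfl⟩, -⟩, rfl⟩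
    · exact hv₀T y hyT hsub
    · refine hv₀T y' hy' ?_
      intro a ha
      have := hsub ha
      rw [mem_insert] at this
      rcases this with rfl | h'
      · exact absurd (hv₀u ha) hmu
      · exact (mem_inter.1 h').1

/-- **(S1) for a witness-free residue instance** with no singleton of `ū` in `U` and an outside
member: every member of `U` strictly inside `u` is a member of `T`. -/
theorem mem_of_mem_upSet_of_ne_of_noWitness (h : RInst S L' T u) (hnt : ¬ Tight T)
    (hB : ∀ m ∈ S \ u, S.erase m ∉ L') (hout : ∃ y ∈ T, ¬ y ⊆ u) (hnw : ∀ t ∈ T, t ∉ L') :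
    ∀ x ∈ upSet S L', x ⊆ u → x ≠ u → x ∈ T := by
  intro x hx hxu hxne
  refine mem_of_mem_of_ne_of_noWitness_of_sdiff_mem (U := upSet S L') (C := cpx T) h.hdown
    ?_ (fun x hx => mem_cpx.1 hx) h.mem_of_mem_upSet hnw
    (h.exists_mem_subset_of_mem_upSet hnt hB hout) h.empty_mem h.hu h.not_mem_cpx ?_ ?_ hx hxu hxne
  · intro y hy _
    exact h.hdown _ (mem_upSet.1 hy) _ (sdiff_subset_sdiff h.huS (subset_refl _))
  · intro x hxL hxu hx'
    rcases h.hsig x hxL hxu with h' | ⟨y, hy, hxy⟩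
    · exact absurd h' hx'
    · exact mem_cpx_of_subset hy hxy
  · exact card_inter_eq_card_complWithin_inter_add_one h.hdown h.hne h.hTS h.hTU h.hcnt h.huS h.hu
      h.hsig h.hao (fun x hx => mem_cpx.1 hx) (fun t ht x hx => mem_cpx_of_subset ht hx)

/-- **The lift (Addendum 39, Step 3).** A witness of the merged instance gives a witness of `T`. -/
theorem exists_witness_of_merge (h : RInst S L' T u) (hnt : ¬ Tight T)
    (hB : ∀ m ∈ S \ u, S.erase m ∉ L') (hmu : m ∉ u) (hout : ∃ y ∈ T, ¬ y ⊆ u)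
    (hw : ∃ y ∈ mergeT T u m, y ∈ mergeL S u L' m) : ∃ y ∈ T, y ∈ L' := by
  by_contra hno
  push Not at hno
  have hS1 := h.mem_of_mem_upSet_of_ne_of_noWitness hnt hB hout hno
  obtain ⟨y, hy, hyL⟩ := hw
  rcases mem_mergeT.1 hy with ⟨hyT, hyu⟩ | ⟨t, ⟨⟨y', hy', rfl⟩, -⟩, rfl⟩
  · -- a witness inside `u` is a witness of `T`
    rcases mem_mergeL.1 hyL with ⟨hyL', -⟩ | ⟨x, -, rfl⟩
    · exact hno y hyT hyL'
    · exact hmu (hyu (mem_insert_self m x))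
  · -- a witness `insert m t` has `t ∈ Λ`, so `u \ t ∈ U` and the lift applies
    rcases mem_mergeL.1 hyL with ⟨-, hsub⟩ | ⟨x, hx, hxeq⟩
    · exact hmu (hsub (mem_insert_self m _))
    · have hxu : x ⊆ u := (mem_link.1 hx).1
      have hmx : m ∉ x := fun h' => hmu (hxu h')
      have hmt : m ∉ y' ∩ u := fun h' => hmu (mem_inter.1 h').2
      have hxt : x = y' ∩ u := by
        rw [← erase_insert hmx, hxeq, erase_insert hmt]
      subst hxt
      by_cases hne : (y' ∩ u).Nonempty
      · obtain ⟨w, hw, hwL⟩ := exists_mem_inter_of_trace_sdiff_mem_of_sdiff_mem (U := upSet S L')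
          (T := T) hS1 (h.hdown _ (h.hTU y' hy') _ (sdiff_subset_sdiff h.huS (subset_refl _)))
          hne (mem_link.1 hx).2
        exact hno w hw hwL
      · -- an empty trace: `y' ⊆ S \ u ∈ L'`, so `y'` is a witness
        rw [not_nonempty_iff_eq_empty] at hne
        refine hno y' hy' (h.hdown _ h.huU _ ?_)
        intro a ha
        refine mem_sdiff.2 ⟨h.hTS y' hy' ha, fun hau => ?_⟩
        have : a ∈ y' ∩ u := mem_inter.2 ⟨ha, hau⟩
        rw [hne] at this
        exact notMem_empty a this

end RInst

end PercRepro.MSTight
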